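import Summits.Ventures.Crystal3D.Theorems.StickyWulffConstantGenericWallFloorMixedDozenRules
import Summits.Ventures.Crystal3D.Theorems.StickyWulffConstantCoaxialWallLawFrame
import HarnessLib

/-!
# A triangle of slots determines the slot dozen (frame rigidity for the v2 line automaton)

HONEST FRAMING. Part of the venture `Summits/Ventures/Crystal3D` (cell `crystal3d-full`), helper for the
crux `CoaxialWallLaw` (stmt-Ventures-19481) of `route-Ventures-StickyWulffConstant`, REGISTERED line
`WallLedgerF` (planner cf-p1 gen 16), open stub `stub_coaxialTwoSlabAdhesion` (general fillings).  Brick T of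
the v2 (NET) line automaton (memo F-NET-AUTOMATON-v2, evidence on the crux item): the state certificate of
the v2 automaton is a TRIANGLE of present neighbours, and the floor argument («no foreign-class line reaches
the complete bottom sample») needs: a frame whose triangle of slots lies in another frame's slot dozen has
the same slot dozen.  Rung credit only; F-C1 not moved.

* `fccSlots_eq_image_of_triangle` — if `a, b, c ∈ fccSlots` meet pairwise at `60°` (`⟪·,·⟫ = ½`), the slot
  dozen is `{±a, ±b, ±c, ±(a − b), ±(a − c), ±(b − c)}` (the root system `A₃` from a base triangle): the
  twelve vectors are unit lattice vectors, and they are distinct (the functional `⟪·,a⟫ + 3⟪·,b⟫ + 9⟪·,c⟫`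
  separates them), so they exhaust the `12` slots (`card_fccSlots`).
* `image_fccSlots_eq_of_triangle` — for linear isometries `F, L`: if `F a, F b, F c ∈ L '' fccSlots` for such
  a triangle then `F '' fccSlots = L '' fccSlots`.

WHAT THIS IS NOT: not the stub; F-C1 not moved.
-/

noncomputable section

namespace Summit.Ventures.Crystal3D.Theorems

open Summit.Ventures.Crystal3D Finset
open Literature.MathematicalPhysics.StatisticalMechanics (fccStacking)
open scoped InnerProductSpace

open scoped Classical in
/-- **A `60°` triangle of slots generates the slot dozen.**  See the module docstring. -/
theorem fccSlots_eq_image_of_triangle {a b c : EuclideanSpace ℝ (Fin 3)}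
    (ha : a ∈ fccSlots) (hb : b ∈ fccSlots) (hc : c ∈ fccSlots)
    (hab : ⟪a, b⟫_ℝ = 1 / 2) (hac : ⟪a, c⟫_ℝ = 1 / 2) (hbc : ⟪b, c⟫_ℝ = 1 / 2) :
    fccSlots = (Finset.univ : Finset (Fin 12)).image
      (![a, b, c, -a, -b, -c, a - b, b - a, a - c, c - a, b - c, c - b] : Fin 12 → EuclideanSpace ℝ (Fin 3)) := by
  set s : Fin 12 → EuclideanSpace ℝ (Fin 3) := ![a, b, c, -a, -b, -c, a - b, b - a, a - c, c - a, b - c, c - b]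
    with hs
  have hna : ‖a‖ = 1 := norm_eq_one_of_mem_fccSlots ha
  have hnb : ‖b‖ = 1 := norm_eq_one_of_mem_fccSlots hb
  have hnc : ‖c‖ = 1 := norm_eq_one_of_mem_fccSlots hc
  have hba : ⟪b, a⟫_ℝ = 1 / 2 := by rw [real_inner_comm]; exact hab
  have hca : ⟪c, a⟫_ℝ = 1 / 2 := by rw [real_inner_comm]; exact hac
  have hcb : ⟪c, b⟫_ℝ = 1 / 2 := by rw [real_inner_comm]; exact hbc
  have hΛa := mem_fcc_of_mem_fccSlots ha
  have hΛb := mem_fcc_of_mem_fccSlots hb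
  have hΛc := mem_fcc_of_mem_fccSlots hc
  -- (1) every vector of the dozen is a slot
  have hmem : ∀ i, s i ∈ fccSlots := by
    have hunit : ∀ x y : EuclideanSpace ℝ (Fin 3), ‖x‖ = 1 → ‖y‖ = 1 → ⟪x, y⟫_ℝ = 1 / 2 → ‖x - y‖ = 1 := by
      intro x y hx hy hxy
      have h : ‖x - y‖ ^ 2 = 1 := by
        rw [@norm_sub_sq ℝ, hx, hy, hxy]; norm_num
      nlinarith [norm_nonneg (x - y)]
    intro i
    fin_cases i
    · exact ha
    · exact hb
    · exact hc
    · exact neg_mem_fccSlots ha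
    · exact neg_mem_fccSlots hb
    · exact neg_mem_fccSlots hc
    · exact mem_fccSlots_of_unit (fcc_sub_site_mem hΛa hΛb) (hunit a b hna hnb hab)
    · exact mem_fccSlots_of_unit (fcc_sub_site_mem hΛb hΛa) (hunit b a hnb hna hba)
    · exact mem_fccSlots_of_unit (fcc_sub_site_mem hΛa hΛc) (hunit a c hna hnc hac)
    · exact mem_fccSlots_of_unit (fcc_sub_site_mem hΛc hΛa) (hunit c a hnc hna hca)
    · exact mem_fccSlots_of_unit (fcc_sub_site_mem hΛb hΛc) (hunit b c hnb hnc hbc)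
    · exact mem_fccSlots_of_unit (fcc_sub_site_mem hΛc hΛb) (hunit c b hnc hnb hcb)
  -- (2) the twelve vectors are distinct: the functional `2⟪·,a⟫ + 6⟪·,b⟫ + 18⟪·,c⟫` separates them
  have hsep : ∀ i, 2 * ⟪s i, a⟫_ℝ + 6 * ⟪s i, b⟫_ℝ + 18 * ⟪s i, c⟫_ℝ =
      ((![14, 16, 22, -14, -16, -22, -2, 2, -8, 8, -6, 6] : Fin 12 → ℤ) i : ℝ) := by
    intro i
    fin_cases i <;>
      simp [hs, inner_neg_left, inner_sub_left, hna, hnb, hnc, hab, hba, hac, hca, hbc, hcb] <;> norm_num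
  have hT : Function.Injective (![14, 16, 22, -14, -16, -22, -2, 2, -8, 8, -6, 6] : Fin 12 → ℤ) := by decide
  have hinj : Function.Injective s := by
    intro i j hij
    have h : (((![14, 16, 22, -14, -16, -22, -2, 2, -8, 8, -6, 6] : Fin 12 → ℤ) i : ℤ) : ℝ) =
        ((![14, 16, 22, -14, -16, -22, -2, 2, -8, 8, -6, 6] : Fin 12 → ℤ) j : ℤ) := by
      rw [← hsep i, ← hsep j, hij]
    exact hT (by exact_mod_cast h)
  -- (3) cardinality
  symm
  apply Finset.eq_of_subset_of_card_le
  · intro x hx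
    rw [Finset.mem_image] at hx
    obtain ⟨i, -, rfl⟩ := hx
    exact hmem i
  · rw [card_fccSlots, Finset.card_image_of_injective _ hinj, Finset.card_univ, Fintype.card_fin]

/-- **Frame rigidity from a triangle.**  If a linear isometry `F` maps a `60°` triangle of slots into the
slot dozen of the frame `L`, then `F` and `L` have the same slot dozen. -/
theorem image_fccSlots_eq_of_triangle (F L : EuclideanSpace ℝ (Fin 3) ≃ₗᵢ[ℝ] EuclideanSpace ℝ (Fin 3))
    {a b c : EuclideanSpace ℝ (Fin 3)} (ha : a ∈ fccSlots) (hb : b ∈ fccSlots) (hc : c ∈ fccSlots)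
    (hab : ⟪a, b⟫_ℝ = 1 / 2) (hac : ⟪a, c⟫_ℝ = 1 / 2) (hbc : ⟪b, c⟫_ℝ = 1 / 2)
    (hFa : F a ∈ (L : EuclideanSpace ℝ (Fin 3) → EuclideanSpace ℝ (Fin 3)) '' ↑fccSlots)
    (hFb : F b ∈ (L : EuclideanSpace ℝ (Fin 3) → EuclideanSpace ℝ (Fin 3)) '' ↑fccSlots)
    (hFc : F c ∈ (L : EuclideanSpace ℝ (Fin 3) → EuclideanSpace ℝ (Fin 3)) '' ↑fccSlots) :
    (F : EuclideanSpace ℝ (Fin 3) → EuclideanSpace ℝ (Fin 3)) '' ↑fccSlots =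
      (L : EuclideanSpace ℝ (Fin 3) → EuclideanSpace ℝ (Fin 3)) '' ↑fccSlots := by
  classical
  obtain ⟨a', ha', hFa'⟩ := hFa
  obtain ⟨b', hb', hFb'⟩ := hFb
  obtain ⟨c', hc', hFc'⟩ := hFc
  rw [Finset.mem_coe] at ha' hb' hc'
  -- the pulled-back triangle `a', b', c'` is again a `60°` triangle of slots
  have g_inner : ∀ x y x' y' : EuclideanSpace ℝ (Fin 3), L x' = F x → L y' = F y → ⟪x', y'⟫_ℝ = ⟪x, y⟫_ℝ := by
    intro x y x' y' hx hy
    rw [← LinearIsometryEquiv.inner_map_map L x' y', hx, hy, LinearIsometryEquiv.inner_map_map]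
  have hab' : ⟪a', b'⟫_ℝ = 1 / 2 := by rw [g_inner a b a' b' hFa' hFb', hab]
  have hac' : ⟪a', c'⟫_ℝ = 1 / 2 := by rw [g_inner a c a' c' hFa' hFc', hac]
  have hbc' : ⟪b', c'⟫_ℝ = 1 / 2 := by rw [g_inner b c b' c' hFb' hFc', hbc]
  have h₁ := fccSlots_eq_image_of_triangle ha hb hc hab hac hbc
  have h₂ := fccSlots_eq_image_of_triangle ha' hb' hc' hab' hac' hbc'
  -- both images are the dozen generated by `F a, F b, F c`
  have key : ∀ (G : EuclideanSpace ℝ (Fin 3) ≃ₗᵢ[ℝ] EuclideanSpace ℝ (Fin 3)) (x y z : EuclideanSpace ℝ (Fin 3)),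
      fccSlots = (Finset.univ : Finset (Fin 12)).image
        (![x, y, z, -x, -y, -z, x - y, y - x, x - z, z - x, y - z, z - y] : Fin 12 → EuclideanSpace ℝ (Fin 3)) →
      (G : EuclideanSpace ℝ (Fin 3) → EuclideanSpace ℝ (Fin 3)) '' ↑fccSlots =
        ↑((Finset.univ : Finset (Fin 12)).image
          (![G x, G y, G z, -G x, -G y, -G z, G x - G y, G y - G x, G x - G z, G z - G x, G y - G z, G z - G y] :
            Fin 12 → EuclideanSpace ℝ (Fin 3))) := by
    intro G x y z h
    rw [h, Finset.coe_image, Finset.coe_image, ← Set.image_comp]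
    refine congrArg (fun f : Fin 12 → EuclideanSpace ℝ (Fin 3) => f '' _) ?_
    funext i
    fin_cases i <;> simp [map_neg, map_sub]
  rw [key F a b c h₁, key L a' b' c' h₂, hFa', hFb', hFc']

end Summit.Ventures.Crystal3D.Theorems

end
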